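import Summits.Ventures.Crystal3D.Theorems.StickyWulffConstantGenericWallFloorSlotSum
import HarnessLib

/-!
# The k-FOLD TOP census target of line `WallLedgerF` (crux `CoaxialWallLaw`, stmt-Ventures-19481) — DEFINITIONS file

HONEST FRAMING. Part of the venture `Summits/Ventures/Crystal3D` (cell `crystal3d-full`), route
`route-Ventures-StickyWulffConstant`, crux `CoaxialWallLaw`, REGISTERED line `WallLedgerF`, open stub
`stub_coaxialTwoSlabAdhesion`.  This file DEFINES (does not prove) the one local census statement on which the
SHARP end multiplicity of the exact end accounting rests (memo F-CONSTANT-g6 §3, evidence #14 on the crux item):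
with it, the in-plane word automaton charges every reachable line end to its OWN ball with multiplicity at most
the ball's deficiency `12 − deg`, and the twin law reaches the constant `√6/4 > ½` (next bricks).  It is an
object POSITED BY THE ROUTE — a finite, certifiable packing statement in the family of 19480's `DoubleTopFar` /
`DoubleStarCoaxialAt` (`…GenericWallFloorDoubleTopFar`, certified twice: R39d, R41e) — NOT a published fact and NOT
proved here.  Rung credit only; F-C1 not moved.

**`KFoldTopDeficit`.**  In a `1`-separated configuration `X`, let a ball `b ∈ X` carry `k ≥ 2` ARRIVAL DATA
`(A, u)` (a frame and a slot) such that, for each of them, the predecessor `p = b − A u ∈ X` READS EXACTLY in the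
frame `A` — it has a full `A`-slot shell, or it reads as a coherent twin dozen of `(A, n)` for a unit `{111}`
normal `n` of `A` (own closed half-dozen `⟪A w, n⟫ ≤ 0` present, the three mirror balls `p + A w − 2⟪A w, n⟫ n`
(`⟪A w, n⟫ < 0`) present, the three far slots `⟪A w, n⟫ > 0` empty) — with pairwise DISTINCT predecessors and
pairwise NON-CO-AXIAL frames (slot dozens neither equal nor mirror images of each other across a unit `{111}`
normal).  Then `deg b + k ≤ 12`: the ball tops at most `12 − deg b` such clusters.
These are exactly the data carried by `k` distinct REACHED states of the word automaton at `b`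
(`word_move_target`, `…EndStar`/`…EndCharge` stars, `word_reached_pred_ne`, `word_reached_not_coaxial` of
`…EndUnique`).  Census decomposition: `k = 2` with two full shells = the content of `DoubleStarCoaxialAt`
(`DoubleTopFar` ⇒ an eleventh neighbour off the two stars forces co-axial frames); `k = 2` with one or two
twin-reading predecessors (hcp-type 13-clusters) and `k ≥ 3` are the NEW rows (cf-p2).  No distance hypothesis on
the predecessors is made (touching exact clusters of non-co-axial frames do not exist; the certifier sees them as
trivial cases), as in `DoubleStarCoaxialAt`.

WHAT THIS IS NOT: a theorem; the `k = 1` case (an end ball is unsaturated) is NOT part of it — that is the E1 rows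
C12-55 / A12 glide star (`…EndCharge`); rung F-C1 not moved.
-/

noncomputable section

namespace Summit.Ventures.Crystal3D.Theorems

open Summit.Ventures.Crystal3D Finset
open scoped InnerProductSpace

open scoped Classical in
/-- **The k-fold top census target** (`k ≥ 2` exact arrival clusters through one ball with distinct centres and
pairwise non-co-axial frames leave at most `12 − k` contacts at that ball).  See the module docstring.  Posited by
the route (certified-computation target, family of `DoubleTopFar`); NOT proved. -/
def KFoldTopDeficit : Prop :=
  ∀ (X : Finset (EuclideanSpace ℝ (Fin 3))), (∀ p ∈ X, ∀ q ∈ X, p ≠ q → 1 ≤ dist p q) →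
    ∀ b ∈ X, ∀ S : Finset ((EuclideanSpace ℝ (Fin 3) ≃ₗᵢ[ℝ] EuclideanSpace ℝ (Fin 3)) × EuclideanSpace ℝ (Fin 3)),
      2 ≤ S.card →
      (∀ s ∈ S, s.2 ∈ fccSlots ∧ b - s.1 s.2 ∈ X) →
      -- every predecessor reads exactly in its arrival frame: full shell, or coherent twin dozen
      (∀ s ∈ S, (∀ w ∈ fccSlots, b - s.1 s.2 + s.1 w ∈ X) ∨
        ∃ n : EuclideanSpace ℝ (Fin 3), ‖n‖ = 1 ∧
          (∀ w ∈ fccSlots, ⟪s.1 w, n⟫_ℝ = 0 ∨ ⟪s.1 w, n⟫_ℝ = Real.sqrt (2 / 3) ∨ ⟪s.1 w, n⟫_ℝ = -Real.sqrt (2 / 3)) ∧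
          (∀ w ∈ fccSlots, ⟪s.1 w, n⟫_ℝ ≤ 0 → b - s.1 s.2 + s.1 w ∈ X) ∧
          (∀ w ∈ fccSlots, ⟪s.1 w, n⟫_ℝ < 0 → b - s.1 s.2 + (s.1 w - (2 * ⟪s.1 w, n⟫_ℝ) • n) ∈ X) ∧
          (∀ w ∈ fccSlots, 0 < ⟪s.1 w, n⟫_ℝ → b - s.1 s.2 + s.1 w ∉ X)) →
      -- distinct predecessors
      (∀ s ∈ S, ∀ t ∈ S, s ≠ t → b - s.1 s.2 ≠ b - t.1 t.2) →
      -- pairwise non-co-axial arrival frames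
      (∀ s ∈ S, ∀ t ∈ S, s ≠ t →
        (t.1 : EuclideanSpace ℝ (Fin 3) → EuclideanSpace ℝ (Fin 3)) '' ↑fccSlots ≠
          (s.1 : EuclideanSpace ℝ (Fin 3) → EuclideanSpace ℝ (Fin 3)) '' ↑fccSlots ∧
        ∀ n : EuclideanSpace ℝ (Fin 3), ‖n‖ = 1 →
          (∀ w ∈ fccSlots, ⟪s.1 w, n⟫_ℝ = 0 ∨ ⟪s.1 w, n⟫_ℝ = Real.sqrt (2 / 3) ∨ ⟪s.1 w, n⟫_ℝ = -Real.sqrt (2 / 3)) →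
          (t.1 : EuclideanSpace ℝ (Fin 3) → EuclideanSpace ℝ (Fin 3)) '' ↑fccSlots ≠
            (fun x => s.1 x - (2 * ⟪s.1 x, n⟫_ℝ) • n) '' ↑fccSlots) →
      (X.filter fun q => dist b q = 1).card + S.card ≤ 12

/-- `KFoldTopDeficit` restated with the bound in subtraction-free `ℝ` form, for the ledgers. -/
theorem KFoldTopDeficit.card_le (hK : KFoldTopDeficit) {X : Finset (EuclideanSpace ℝ (Fin 3))}
    (hX : ∀ p ∈ X, ∀ q ∈ X, p ≠ q → 1 ≤ dist p q) {b : EuclideanSpace ℝ (Fin 3)} (hb : b ∈ X)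
    (S : Finset ((EuclideanSpace ℝ (Fin 3) ≃ₗᵢ[ℝ] EuclideanSpace ℝ (Fin 3)) × EuclideanSpace ℝ (Fin 3)))
    (h2 : 2 ≤ S.card) (hS : ∀ s ∈ S, s.2 ∈ fccSlots ∧ b - s.1 s.2 ∈ X)
    (hread : ∀ s ∈ S, (∀ w ∈ fccSlots, b - s.1 s.2 + s.1 w ∈ X) ∨
        ∃ n : EuclideanSpace ℝ (Fin 3), ‖n‖ = 1 ∧
          (∀ w ∈ fccSlots, ⟪s.1 w, n⟫_ℝ = 0 ∨ ⟪s.1 w, n⟫_ℝ = Real.sqrt (2 / 3) ∨ ⟪s.1 w, n⟫_ℝ = -Real.sqrt (2 / 3)) ∧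
          (∀ w ∈ fccSlots, ⟪s.1 w, n⟫_ℝ ≤ 0 → b - s.1 s.2 + s.1 w ∈ X) ∧
          (∀ w ∈ fccSlots, ⟪s.1 w, n⟫_ℝ < 0 → b - s.1 s.2 + (s.1 w - (2 * ⟪s.1 w, n⟫_ℝ) • n) ∈ X) ∧
          (∀ w ∈ fccSlots, 0 < ⟪s.1 w, n⟫_ℝ → b - s.1 s.2 + s.1 w ∉ X))
    (hdist : ∀ s ∈ S, ∀ t ∈ S, s ≠ t → b - s.1 s.2 ≠ b - t.1 t.2)
    (hnc : ∀ s ∈ S, ∀ t ∈ S, s ≠ t →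
        (t.1 : EuclideanSpace ℝ (Fin 3) → EuclideanSpace ℝ (Fin 3)) '' ↑fccSlots ≠
          (s.1 : EuclideanSpace ℝ (Fin 3) → EuclideanSpace ℝ (Fin 3)) '' ↑fccSlots ∧
        ∀ n : EuclideanSpace ℝ (Fin 3), ‖n‖ = 1 →
          (∀ w ∈ fccSlots, ⟪s.1 w, n⟫_ℝ = 0 ∨ ⟪s.1 w, n⟫_ℝ = Real.sqrt (2 / 3) ∨ ⟪s.1 w, n⟫_ℝ = -Real.sqrt (2 / 3)) →
          (t.1 : EuclideanSpace ℝ (Fin 3) → EuclideanSpace ℝ (Fin 3)) '' ↑fccSlots ≠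
            (fun x => s.1 x - (2 * ⟪s.1 x, n⟫_ℝ) • n) '' ↑fccSlots) :
    (S.card : ℝ) ≤ 12 - ((X.filter fun q => dist b q = 1).card : ℝ) := by
  classical
  have h := hK X hX b hb S h2 hS hread hdist hnc
  have h' : (((X.filter fun q => dist b q = 1).card + S.card : ℕ) : ℝ) ≤ 12 := by exact_mod_cast h
  push_cast at h'
  linarith

end Summit.Ventures.Crystal3D.Theorems

end
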